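import Summits.BirchSwinnertonDyer.BirchSwinnertonDyer.Theses.SemiOrdinaryEisensteinDescent
import Summits.BirchSwinnertonDyer.BirchSwinnertonDyer.Theorems.SemiOrdinaryEisensteinDescentWildKolyvaginUpperAtThreeOfGlobalDivisibility
import HarnessLib

/-!
# Route `SemiOrdinaryEisensteinDescent`: the glue item `WildKolyvaginUpperAtThreeOfSigma`
# (stmt-BirchSwinnertonDyer-20762, gen-1 split of crux Ko 20480) CLOSED by utd-p3 g1's receptacle

`WildKolyvaginUpperAtThreeOfSigma := WildSigmaDivisibilityAtThree → KolyvaginStructureInputsAtThree →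
WildKolyvaginUpperAtThree`: J (Σ-form global divisibility of the derived Heegner points at the additive prime
`3`, crux 20760) and the two published structure inputs BY NAME (Kolyvagin 1990 Thm. A ∧ Matar–Nekovář 2019
Thm. 0.7/§0.11, support 20761) give the crux Ko — by `wildKolyvaginUpperAtThree_of_globalDivisibility`
(p544141), whose displayed hypothesis IS J verbatim. Pure glue; BSD is not proved by any of this.

References: [Jetchev2008] Conj. 1.3 (p. 812); [MatarNekovar2019] Thm. 0.7, §0.11; [Kolyvagin1990] Thm. A.
-/

set_option autoImplicit false
set_option linter.dupNamespace false

namespace Summit.BirchSwinnertonDyer.BirchSwinnertonDyer.Theorems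

open Summit.BirchSwinnertonDyer.BirchSwinnertonDyer.Theses.SemiOrdinaryEisensteinDescent

/-- **Glue 20762**: J ∧ (Kolyvagin ∧ Matar–Nekovář by name) ⟹ crux Ko `WildKolyvaginUpperAtThree`, by the
receptacle `wildKolyvaginUpperAtThree_of_globalDivisibility` (p544141). [cite: Jetchev2008, Conj. 1.3 (p. 812)]
[cite: MatarNekovar2019, Thm. 0.7 (p. 456) and §0.11 (p. 457)] -/
theorem wildKolyvaginUpperAtThreeOfSigma_proof : WildKolyvaginUpperAtThreeOfSigma :=
  fun hJ hS ↦ WildKolyvaginUpperAtThreeOfGlobalDivisibility.wildKolyvaginUpperAtThree_of_globalDivisibility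
    hS.1 hS.2 hJ

end Summit.BirchSwinnertonDyer.BirchSwinnertonDyer.Theorems
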